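import Literature.Geometry.Riemannian.HeatKernelVeryWeak
import Literature.Geometry.Riemannian.HeatKernelAbsolutelyContinuous
import Literature.Geometry.Riemannian.SpaceTimeKernelIntegral
import Literature.Geometry.Riemannian.LinearHeatVeryWeakUniformBound
import HarnessLib

/-!
# The space-time density of the heat kernel measures of a Ricci flow is a very weak solution of
# the time-reversed conjugate heat equation (Bamler 2020a, §2.3)

R. Bamler, *Entropy and heat kernel bounds on a Ricci flow background*, arXiv:2008.07093 (2020a),
§2.3: `dν_{x,t;s} = K(x,t;·,s) dg_s` with `□*_{(y,s)} K = 0`. Towards the smooth kernel `K`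
(`RicciFlowConjugateHeatKernel.lean`) this file produces, for a `C^∞` family `h` of Riemannian
metrics on a closed manifold `M` (modelled on `ℝᵐ`) which is a Ricci flow on `[a, t]` and a base
point `x`, a measurable nonnegative function `u` on `M × ℝ` — the Radon–Nikodym density of the
space-time measure `dν_{x,t;−σ} dσ` on `M × (−t, −a)` with respect to `dV_{h(−σ)} dσ`, written in
the REVERSED time `σ = −s` in which the conjugate heat equation becomes a forward heat-type
equation — such that

* `∫ u ρ̃ Z d(V_{h(0)} ⊗ dσ) = ∫_{(−t,−a)} ∫ Z(·, σ) dν_{x,t;−σ} dσ` for bounded continuous `Z`,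
  `ρ̃(y, σ) = dV_{h(−σ)}/dV_{h(0)}(y)` (`integral_toReal_rnDeriv_compProd_mul`,
  `SpaceTimeKernelIntegral.lean`, through the absolute continuity `ν_{x,t;s} ≪ V_{h(s)}` of
  `HeatKernelAbsolutelyContinuous.lean`);
* `u` is integrable on `M × (−t, −a)`;
* `u` is a VERY WEAK solution of `∂_σ u = Δ_{h(−σ)} u − Q u`, `Q = ∂_σρ̃/ρ̃` (`= R(·, −σ)` along the
  Ricci flow), in the exact format of the hypoellipticity theorem
  `exists_contMDiffOn_ae_eq_of_linearHeat_veryWeak` (`LinearHeatWeakRegularity.lean`): this is the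
  very weak conjugate heat equation of the kernel measures
  (`IsRicciFlow.setIntegral_integral_testOp_heatKernelMeasure_eq_zero`, `HeatKernelVeryWeak.lean`)
  after the substitution `σ = −s`.

(`IsRicciFlow.exists_reversed_veryWeak_density`.) Everything is proved; no definitions, no named
facts.

## References

* R. H. Bamler, *Entropy and heat kernel bounds on a Ricci flow background*, arXiv:2008.07093
  (2020), §2.3. [Bamler2020Entropy]
-/

noncomputable section

open Bundle Set Function Filter Manifold MeasureTheory Measure TopologicalSpace ProbabilityTheory
open scoped Manifold ContDiff Topology ENNReal NNReal

namespace Literature.Geometry.Riemannian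

open Lorentzian Lorentzian.PseudoRiemannianMetric

section SpaceTimeDensity

variable {m : ℕ} {H : Type*} [TopologicalSpace H]
  {I : ModelWithCorners ℝ (EuclideanSpace ℝ (Fin m)) H} [I.Boundaryless]
  {M : Type*} [TopologicalSpace M] [ChartedSpace H M] [IsManifold I ∞ M]
  [T2Space M] [CompactSpace M] [SecondCountableTopology M] [MeasurableSpace M] [BorelSpace M]
  {h : ℝ → PseudoRiemannianMetric I ∞ (EuclideanSpace ℝ (Fin m)) (TangentSpace I : M → Type _)}
  {cov : ℝ → CovariantDerivative I (EuclideanSpace ℝ (Fin m)) (TangentSpace I : M → Type _)}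

variable (hh : IsContMDiffFamilyOn ∞ h univ) (hR : ∀ r, (h r).IsRiemannian)

/-- **The very weak density of the heat kernel measures in reversed time.** Let `h` be a `C^∞`
family of Riemannian metrics on the closed manifold `M` which is a Ricci flow on `[a, t]`,
`a < t`, and `x ∈ M`; write `ρ̃(y, σ) = dV_{h(−σ)}/dV_{h(0)}(y)` and `Q = ∂_σρ̃/ρ̃`. There is a
measurable `u ≥ 0` on `M × ℝ`, integrable on `M × (−t, −a)` for `dV_{h(0)} ⊗ dσ`, with

* `∫ u ρ̃ Z d(V_{h(0)} ⊗ dσ) = ∫_{σ ∈ (−t,−a)} ∫ Z(y, σ) dν_{x,t;−σ}(y) dσ` for every continuous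
  bounded `Z` (so `u(·, σ) dV_{h(−σ)} = ν_{x,t;−σ}` for a.e. `σ`), and
* the very weak heat-type equation `∫ u (−∂_σ(ρ̃ζ) − ρ̃ Δ_{h(−σ)}ζ + ρ̃ Q ζ) d(V_{h(0)} ⊗ dσ) = 0` for
  every smooth `ζ` compactly supported in `M × (−t, −a)` (Bamler 2020a, §2.3: `□* K = 0` in
  `(y, s)`, very weakly, in the time `σ = −s`). [cite: Bamler2020Entropy, §2.3] -/
theorem IsRicciFlow.exists_reversed_veryWeak_density {a t : ℝ} (hat : a < t)
    (hflow : IsRicciFlow h cov (Icc a t)) (x : M) :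
    ∃ u : M × ℝ → ℝ, Measurable u ∧ (∀ p, 0 ≤ u p) ∧
      IntegrableOn u (univ ×ˢ Ioo (-t) (-a)) ((h 0).riemVolume.prod (volume : Measure ℝ)) ∧
      (∀ Z : M × ℝ → ℝ, Continuous Z → (∃ C, ∀ p, |Z p| ≤ C) →
        ∫ p, u p * (h (-p.2)).densityRatio (h 0) p.1 * Z p
            ∂(h 0).riemVolume.prod (volume : Measure ℝ) =
          ∫ σ in Ioo (-t) (-a), ∫ y, Z (y, σ) ∂(heatKernelMeasure hh hR t x (-σ))) ∧
      (∀ ζ : M × ℝ → ℝ, ContMDiff (I.prod 𝓘(ℝ, ℝ)) 𝓘(ℝ, ℝ) ∞ ζ → HasCompactSupport ζ →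
        tsupport ζ ⊆ univ ×ˢ Ioo (-t) (-a) →
        ∫ p, u p * (-(deriv (fun s ↦ (h (-s)).densityRatio (h 0) p.1 * ζ (p.1, s)) p.2) -
            (h (-p.2)).densityRatio (h 0) p.1 *
              (h (-p.2)).laplaceBeltrami (fun y ↦ ζ (y, p.2)) p.1 +
            (h (-p.2)).densityRatio (h 0) p.1 *
              (deriv (fun s ↦ (h (-s)).densityRatio (h 0) p.1) p.2 /
                (h (-p.2)).densityRatio (h 0) p.1) * ζ p)
            ∂(h 0).riemVolume.prod (volume : Measure ℝ) = 0) := by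
  -- reference measure, reversed family, density ratio
  set μ₀ : Measure M := (h 0).riemVolume with hμ₀
  haveI : IsFiniteMeasure μ₀ := ⟨(h 0).riemVolume_univ_lt_top⟩
  set T : Set ℝ := Ioo (-t) (-a) with hT
  have hTo : IsOpen T := isOpen_Ioo
  set ρ : M × ℝ → ℝ := fun p ↦ (h (-p.2)).densityRatio (h 0) p.1 with hρ
  have hρs : ContMDiff (I.prod 𝓘(ℝ, ℝ)) 𝓘(ℝ, ℝ) ∞ ρ := contMDiff_densityRatio_comp_neg hh hR
  have hρpos : ∀ p, 0 < ρ p := fun p ↦ densityRatio_pos (hR _) (hR 0) _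
  -- the reversed kernel `σ ↦ ν_{x,t;−σ}` and its absolute continuity over `T`
  set κ : Kernel ℝ M := ⟨fun σ ↦ heatKernelMeasure hh hR t x (-σ),
    (measurable_heatKernelMeasure_left hh hR t x).comp measurable_neg⟩ with hκ
  have hκapp : ∀ σ, κ σ = heatKernelMeasure hh hR t x (-σ) := fun σ ↦ rfl
  haveI : IsMarkovKernel κ := ⟨fun σ ↦ by rw [hκapp]; infer_instance⟩
  have hκac : ∀ σ ∈ T, κ σ ≪ μ₀ := by
    intro σ hσ
    have hs : -σ ∈ Ioo a t := ⟨by linarith [hσ.2], by linarith [hσ.1]⟩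
    have h1 : heatKernelMeasure hh hR t x (-σ) ≪ (h (-σ)).riemVolume :=
      (hflow.mono (Icc_subset_Icc hs.1.le le_rfl)).heatKernelMeasure_absolutelyContinuous hh hR
        ⟨hs.2, le_rfl⟩ x
    rw [hκapp]
    refine h1.trans ?_
    rw [riemVolume_eq_withDensity_densityRatio (hR (-σ)) (hR 0)]
    exact withDensity_absolutelyContinuous _ _
  -- the space-time density `F` and the candidate `u = F / ρ`
  set F : M × ℝ → ℝ := fun p ↦
    (((volume.restrict T) ⊗ₘ κ).rnDeriv ((volume : Measure ℝ).prod μ₀) (p.2, p.1)).toReal with hF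
  have hFm : Measurable F :=
    ((Measure.measurable_rnDeriv _ _).comp measurable_swap).ennreal_toReal
  have hF0 : ∀ p, 0 ≤ F p := fun p ↦ ENNReal.toReal_nonneg
  have key := fun (Z : M × ℝ → ℝ) (hZ : Continuous Z) (C : ℝ) (hC : ∀ σ ∈ T, ∀ y, |Z (y, σ)| ≤ C) ↦
    integral_toReal_rnDeriv_compProd_mul (μ₀ := μ₀) measurableSet_Ioo κ hκac hZ hC
  have hFint : Integrable F (μ₀.prod (volume : Measure ℝ)) :=
    (key (fun _ ↦ 0) continuous_const 0 (fun _ _ _ ↦ by simp)).2.1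
  refine ⟨fun p ↦ F p / ρ p, hFm.div hρs.continuous.measurable, fun p ↦
    div_nonneg (hF0 p) (hρpos p).le, ?_, ?_, ?_⟩
  · -- integrability on `M × T`: `ρ` is bounded below on `M × [−t, −a]`
    obtain ⟨p₀, -, hp₀⟩ := (isCompact_univ.prod (isCompact_Icc (a := -t) (b := -a))).exists_isMinOn
      ⟨((x, -t) : M × ℝ), mem_univ _, le_rfl, by linarith⟩ hρs.continuous.continuousOn
    have hc : 0 < ρ p₀ := hρpos p₀
    refine Integrable.mono' ((hFint.div_const (ρ p₀)).restrict (s := univ ×ˢ T))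
      ((hFm.div hρs.continuous.measurable).aestronglyMeasurable) ?_
    rw [ae_restrict_iff' (MeasurableSet.univ.prod measurableSet_Ioo)]
    refine Eventually.of_forall fun p hp ↦ ?_
    have hle : ρ p₀ ≤ ρ p := hp₀ ⟨mem_univ _, Ioo_subset_Icc_self hp.2⟩
    rw [Real.norm_eq_abs, abs_div, abs_of_nonneg (hF0 p), abs_of_pos (hρpos p)]
    exact div_le_div_of_nonneg_left (hF0 p) hc hle
  · -- the integral identity
    intro Z hZ ⟨C, hC⟩
    have e : (fun p ↦ F p / ρ p * (h (-p.2)).densityRatio (h 0) p.1 * Z p) = fun p ↦ F p * Z p := by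
      funext p
      show F p / ρ p * ρ p * Z p = F p * Z p
      rw [div_mul_cancel₀ _ (hρpos p).ne']
    rw [e]
    exact (key Z hZ C (fun σ _ y ↦ hC (y, σ))).2.2
  · -- the very weak equation
    intro ζ hζ hζc hζT
    -- the bracket is `ρ · W`, `W = −(∂_σζ + Δ_{h(−σ)}ζ)`
    set W : M × ℝ → ℝ := fun p ↦ -(deriv (fun s ↦ ζ (p.1, s)) p.2 +
      (h (-p.2)).laplaceBeltrami (fun y ↦ ζ (y, p.2)) p.1) with hW
    have hζ' : ContMDiffOn (I.prod 𝓘(ℝ, ℝ)) 𝓘(ℝ, ℝ) ∞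
        (fun p : M × ℝ ↦ (fun s y ↦ ζ (y, s)) p.2 p.1) (univ ×ˢ (univ : Set ℝ)) := by
      simpa using hζ.contMDiffOn
    have hWc : Continuous W := by
      have h1 := contMDiffOn_derivWithin_time_of_uniqueDiffOn (I := I) (u := fun s y ↦ ζ (y, s))
        uniqueDiffOn_univ hζ'
      have h2 := (IsContMDiffFamilyOn.comp_neg hh).contMDiffOn_laplaceBeltrami
        (f := fun s y ↦ ζ (y, s)) uniqueDiffOn_univ hζ'
      simp only [derivWithin_univ, univ_prod_univ, contMDiffOn_univ] at h1 h2
      exact (h1.add h2).continuous.neg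
    have hW0 : ∀ p ∉ tsupport ζ, W p = 0 := fun p hp ↦ by
      obtain ⟨y, σ⟩ := p
      obtain ⟨hd, hL⟩ := deriv_eq_zero_and_laplaceBeltrami_eq_zero_of_notMem_tsupport (h (-σ)) hp
      simp [hW, hd, hL]
    obtain ⟨C, hC⟩ : ∃ C, ∀ p, |W p| ≤ C := by
      obtain ⟨C, hC⟩ := hζc.isCompact.exists_bound_of_continuousOn hWc.continuousOn
      refine ⟨max C 0, fun p ↦ ?_⟩
      by_cases hp : p ∈ tsupport ζ
      · exact ((Real.norm_eq_abs _).symm.le.trans (hC p hp)).trans (le_max_left _ _)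
      · rw [hW0 p hp, abs_zero]; exact le_max_right _ _
    have hbr : ∀ p : M × ℝ, F p / ρ p *
        (-(deriv (fun s ↦ (h (-s)).densityRatio (h 0) p.1 * ζ (p.1, s)) p.2) -
          (h (-p.2)).densityRatio (h 0) p.1 * (h (-p.2)).laplaceBeltrami (fun y ↦ ζ (y, p.2)) p.1 +
          (h (-p.2)).densityRatio (h 0) p.1 *
            (deriv (fun s ↦ (h (-s)).densityRatio (h 0) p.1) p.2 /
              (h (-p.2)).densityRatio (h 0) p.1) * ζ p) = F p * W p := by
      rintro ⟨y, σ⟩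
      have hdρ : DifferentiableAt ℝ (fun s ↦ (h (-s)).densityRatio (h 0) y) σ :=
        differentiableAt_time_of_contMDiff hρs y σ
      have hdζ : DifferentiableAt ℝ (fun s ↦ ζ (y, s)) σ :=
        differentiableAt_time_of_contMDiff hζ y σ
      have hρ0 : (h (-σ)).densityRatio (h 0) y ≠ 0 := (hρpos (y, σ)).ne'
      simp only [hW, hρ]
      rw [deriv_fun_mul hdρ hdζ]
      field_simp
      ring
    simp only [hbr]
    have hid := (key W hWc C (fun σ _ y ↦ hC (y, σ))).2.2
    rw [hid]
    -- substitute `σ = −s` and apply the very weak conjugate heat equation of the kernel measures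
    set ζ' : M × ℝ → ℝ := fun p ↦ ζ (p.1, -p.2) with hζ'def
    have hζ's : ContMDiff (I.prod 𝓘(ℝ, ℝ)) 𝓘(ℝ, ℝ) ∞ ζ' :=
      hζ.comp (contMDiff_fst.prodMk contMDiff_snd.neg)
    set e : M × ℝ ≃ₜ M × ℝ := (Homeomorph.refl M).prodCongr (Homeomorph.neg ℝ) with he
    have heζ : ζ' = ζ ∘ e := by funext p; rfl
    have hζ'c : HasCompactSupport ζ' := by rw [heζ]; exact hζc.comp_homeomorph e
    have hζ'T : tsupport ζ' ⊆ univ ×ˢ Ioo a t := by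
      rw [heζ, tsupport_comp_eq_preimage]
      intro p hp
      have h1 : (e p).2 ∈ Ioo (-t) (-a) := (hζT hp).2
      have h2 : (e p).2 = -p.2 := rfl
      rw [h2] at h1
      exact ⟨mem_univ _, by linarith [h1.2], by linarith [h1.1]⟩
    have hvw := hflow.setIntegral_integral_testOp_heatKernelMeasure_eq_zero hh hR hat x hζ's hζ'c hζ'T
    -- `∫_{(−t,−a)} G(σ) dσ = ∫_{(a,t)} G(−s) ds`
    have hsub : ∫ σ in Ioo (-t) (-a), ∫ y, W (y, σ) ∂(heatKernelMeasure hh hR t x (-σ)) =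
        ∫ s in Ioo a t, ∫ y, W (y, -s) ∂(heatKernelMeasure hh hR t x s) := by
      rw [← integral_Ioc_eq_integral_Ioo, ← intervalIntegral.integral_of_le (by linarith),
        ← integral_Ioc_eq_integral_Ioo, ← intervalIntegral.integral_of_le hat.le,
        ← intervalIntegral.integral_comp_neg]
      simp
    simp only [hκapp]
    rw [hsub, ← hvw]
    refine setIntegral_congr_fun measurableSet_Ioo fun s _ ↦ ?_
    refine integral_congr_ae (Eventually.of_forall fun y ↦ ?_)
    simp only [hW, hζ'def, neg_neg]
    rw [deriv_comp_neg (fun s' ↦ ζ (y, s')) s]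
    ring

end SpaceTimeDensity

end Literature.Geometry.Riemannian
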